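import Mathlib
import Literature.Analysis.FluidPDE.SelfSimilarEulerProfile
import Summits.NavierStokesRegularity.NavierStokesRegularity.Theorems.EulerZoomLiouvillePowerGaugeEulerLiouvilleHoopDefs
import HarnessLib

/-!
# Hoop line — the K-TJ‴ faces `HasStraightSlowHighRunsBare ρ V` (alt 8″), `HasStraightRidgeRuns ρ V` (pressure-ridge form) and the
# class-free, scale-free RIDGE-RUN ENERGY LAW `RidgeRunEnergyLaw ρ V` (definitions only)

Sub-problem `NavierStokesRegularity`, crux `PowerGaugeEulerLiouville` (stmt-NavierStokesRegularity-19832; a crux CLASS of self-similar Euler/NS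
strata on the MODEL lattice — not NS regularity).  Texts VERBATIM from nsreg-p2 g41 ROUND-51 «THE CAPS COME FOR FREE» v1.2/v1.3 §2,
`r51/TJbare_Q.lean` sha16 8d19af1dedef3daf (l.51, l.70, l.148).  Landed as definitions so that the JOIN `ridgeRunEnergyLaw` (CORE-uniform p-sfl-p1 +
`HoopCore.capCostBound` + `HoopCore.lateralHoopInequality`), the members `Loc.selfSimilar_ae_eq_zero_of_straightRidgeRunsC2_profile` /
`…straightSlowHighRunsBareC2_profile` (hands) and the LEAD skeleton (`IsKinematicTameProfile ρ c V` alternative 10) reference them BY NAME.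

Relative to alt 8′ `HasStraightSlowHighRunsFree ρ V` (`…HoopRunFreeDefs`) ONE clause changes: the CAP-SPEED clause on the two end discs is REMOVED
(paid by `capCostBound` + `cutSelection`), and the wall clause regains a SPEED part `‖V‖ ≤ νR` on the wall circles of radius `T₀ = β·b`,
`b = R^{−(1+ρ)}`; constraint `β(8ν² + 14γν) < Λ·(½γ(1−γ) − ½λ² − η)`, `γ = 1/(2+ρ)` — no `c`, no `K`, no floor.  `HasStraightRidgeRuns` replaces
the axis clause and the wall-pressure clause by the ONE pressure-ridge clause `P(axis) − ⟨P⟩_θ(σ, βb) ≥ μR²`.  `RidgeRunEnergyLaw ρ V`: every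
straight run of aspect `≥ Λ` at any wall radius `T₀ ≤ b` carrying a pressure ridge `≥ μR²` with wall speed `≤ νR` has tube energy `≥ ε₀R²·length`.
Nothing is proved here; 19832 OPEN; NS regularity NOT proved.  [nsreg-p2 g41 ROUND-51 §2 (v1.2, v1.3 R2); ns-idea-11 HOOP-NOTE §10]
-/

noncomputable section

set_option linter.dupNamespace false

open Set Metric MeasureTheory Function
open scoped RealInnerProductSpace ENNReal NNReal

namespace Summit.NavierStokesRegularity.NavierStokesRegularity.Theorems.PowerGaugeEulerLiouville

open Literature.Analysis Literature.Analysis.FluidPDE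

/-- **K-TJ‴ FACE (alt 8″)** «arbitrarily far out there is a straight slow ∧ Bernoulli-high run of length `≥ Λ·b` (`b = R^{−(1+ρ)}`) inside a QUIET
WALL of radius `β·b`: ambient circle-mean pressure (`≤ h + ηR²`) and speed `≤ νR` on every wall circle», with the ONE constraint
`β(8ν² + 14γν) < Λ·(½γ(1−γ) − ½λ² − η)`, `γ = 1/(2+ρ)` — no budget constant, no cap clause, no interior clause.
Run = image under the rigid motion `x ↦ A x + a` of `HoopCore.solidCyl s₁ s₂ (βb)`. [nsreg-p2 g41 ROUND-51 §2, r51/TJbare_Q.lean VERBATIM; alt 8′ = `HasStraightSlowHighRunsFree`] -/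
def HasStraightSlowHighRunsBare (ρ : ℝ)
    (V : EuclideanSpace ℝ (Fin 3) → EuclideanSpace ℝ (Fin 3)) : Prop :=
  ∀ P' : EuclideanSpace ℝ (Fin 3) → ℝ, IsSelfSimilarEulerProfile (1 / (2 + ρ)) 0 V P' →
    ∃ Λ β lam η ν : ℝ, 0 < Λ ∧ 0 < β ∧ 0 ≤ lam ∧ 0 ≤ η ∧ 0 ≤ ν ∧
      β * (8 * ν ^ 2 + 14 * (1 / (2 + ρ)) * ν) < Λ * ((1 / (2 + ρ)) * (1 - 1 / (2 + ρ)) / 2 - lam ^ 2 / 2 - η) ∧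
      ∀ R₀ : ℝ, ∃ (A : EuclideanSpace ℝ (Fin 3) ≃ₗᵢ[ℝ] EuclideanSpace ℝ (Fin 3)) (a : EuclideanSpace ℝ (Fin 3))
          (R s₁ s₂ h : ℝ),
        R₀ ≤ R ∧ 1 ≤ R ∧ s₁ + Λ * R ^ (-(1 + ρ)) ≤ s₂ ∧
        (∀ x ∈ HoopCore.solidCyl s₁ s₂ (β * R ^ (-(1 + ρ))), R ≤ ‖A x + a‖ ∧ ‖A x + a‖ ≤ 2 * R) ∧
        (∀ σ ∈ Icc s₁ s₂,
            ‖selfSimilarTransport (1 / (2 + ρ)) 0 V (A (σ • eZ) + a)‖ ≤ lam * R ∧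
            h ≤ selfSimilarBernoulli (1 / (2 + ρ)) 0 V P' (A (σ • eZ) + a) ∧
            HoopCore.circleAvg (fun x => P' (A x + a)) σ (β * R ^ (-(1 + ρ))) ≤ h + η * R ^ 2 ∧
            ∀ θ : ℝ, ‖V (A (HoopCore.axisPt σ (β * R ^ (-(1 + ρ))) θ) + a)‖ ≤ ν * R)

/-- **PRESSURE-RIDGE FACE** «arbitrarily far out there is a straight segment of length `≥ Λ·b` carrying a pressure ridge of height `≥ μR²` above the
circle means on a wall of radius `β·b` on which the speed is `≤ νR`», with the constraint `β(8ν² + 14γν) < Λ·μ`.  No Bernoulli function, no transport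
field, no similarity centre in the clauses: the similarity structure enters the member proof only through the coefficients of the net axis law.
(Implied run-by-run by `HasStraightSlowHighRunsBare` with `μ = ½γ(1−γ) − ½λ² − η`.) [nsreg-p2 g41 ROUND-51 §2, r51/TJbare_Q.lean VERBATIM] -/
def HasStraightRidgeRuns (ρ : ℝ)
    (V : EuclideanSpace ℝ (Fin 3) → EuclideanSpace ℝ (Fin 3)) : Prop :=
  ∀ P' : EuclideanSpace ℝ (Fin 3) → ℝ, IsSelfSimilarEulerProfile (1 / (2 + ρ)) 0 V P' →
    ∃ Λ β μ ν : ℝ, 0 < Λ ∧ 0 < β ∧ 0 < μ ∧ 0 ≤ ν ∧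
      β * (8 * ν ^ 2 + 14 * (1 / (2 + ρ)) * ν) < Λ * μ ∧
      ∀ R₀ : ℝ, ∃ (A : EuclideanSpace ℝ (Fin 3) ≃ₗᵢ[ℝ] EuclideanSpace ℝ (Fin 3)) (a : EuclideanSpace ℝ (Fin 3))
          (R s₁ s₂ : ℝ),
        R₀ ≤ R ∧ 1 ≤ R ∧ s₁ + Λ * R ^ (-(1 + ρ)) ≤ s₂ ∧
        (∀ x ∈ HoopCore.solidCyl s₁ s₂ (β * R ^ (-(1 + ρ))), R ≤ ‖A x + a‖ ∧ ‖A x + a‖ ≤ 2 * R) ∧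
        (∀ σ ∈ Icc s₁ s₂,
            μ * R ^ 2 ≤ P' (A (σ • eZ) + a) - HoopCore.circleAvg (fun x => P' (A x + a)) σ (β * R ^ (-(1 + ρ))) ∧
            ∀ θ : ℝ, ‖V (A (HoopCore.axisPt σ (β * R ^ (-(1 + ρ))) θ) + a)‖ ≤ ν * R)

/-- **RIDGE-RUN ENERGY LAW (class-free, scale-free)** «for every `C²` self-similar profile (centre `0`, `γ = 1/(2+ρ)`) and all `Λ, μ, ν` with
`8ν² + 14γν < Λμ` there are `ε₀ > 0` and `R₁` such that EVERY straight run `x ↦ Ax + a` of `solidCyl s₁ s₂ T₀` lying in a shell `R ≤ ‖y‖ ≤ 2R`,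
`R ≥ R₁`, at ANY wall radius `0 < T₀ ≤ b = R^{−(1+ρ)}`, of aspect `s₂ − s₁ ≥ ΛT₀`, carrying a pressure ridge `P(axis) − ⟨P⟩_θ(σ,T₀) ≥ μR²` and
wall speed `≤ νR`, has tube energy `∫_Z |D(V∘g)|_F² ≥ ε₀R²(s₂ − s₁)`» — the quantitative brick of the dust endgame: elongated ridge pieces are never
energetically cheap, at any scale. [nsreg-p2 g41 ROUND-51 v1.2 §2, v1.3 R2, r51/TJbare_Q.lean VERBATIM] -/
def RidgeRunEnergyLaw (ρ : ℝ)
    (V : EuclideanSpace ℝ (Fin 3) → EuclideanSpace ℝ (Fin 3)) : Prop :=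
  ∀ P' : EuclideanSpace ℝ (Fin 3) → ℝ, IsSelfSimilarEulerProfile (1 / (2 + ρ)) 0 V P' →
    ∀ Λ μ ν : ℝ, 0 < Λ → 0 < μ → 0 ≤ ν → 8 * ν ^ 2 + 14 * (1 / (2 + ρ)) * ν < Λ * μ →
      ∃ ε₀ : ℝ, 0 < ε₀ ∧ ∃ R₁ : ℝ,
        ∀ (A : EuclideanSpace ℝ (Fin 3) ≃ₗᵢ[ℝ] EuclideanSpace ℝ (Fin 3)) (a : EuclideanSpace ℝ (Fin 3)) (R s₁ s₂ T₀ : ℝ),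
          R₁ ≤ R → 1 ≤ R → 0 < T₀ → T₀ ≤ R ^ (-(1 + ρ)) → s₁ + Λ * T₀ ≤ s₂ →
          (∀ x ∈ HoopCore.solidCyl s₁ s₂ T₀, R ≤ ‖A x + a‖ ∧ ‖A x + a‖ ≤ 2 * R) →
          (∀ σ ∈ Icc s₁ s₂,
              μ * R ^ 2 ≤ P' (A (σ • eZ) + a) - HoopCore.circleAvg (fun x => P' (A x + a)) σ T₀ ∧
              ∀ θ : ℝ, ‖V (A (HoopCore.axisPt σ T₀ θ) + a)‖ ≤ ν * R) →
            ε₀ * R ^ 2 * (s₂ - s₁) ≤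
              ∫ x in HoopCore.solidCyl s₁ s₂ T₀, frobeniusNormSq (fderiv ℝ (fun z => V (A z + a)) x)

end Summit.NavierStokesRegularity.NavierStokesRegularity.Theorems.PowerGaugeEulerLiouville

end
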